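import Summits.CriticalPhenomena.PercolationContinuityZ3.Theorems.PercNearOneGluingNoHeavyLowerTailSunflowerPrincipalCore
import Summits.CriticalPhenomena.PercolationContinuityZ3.Theorems.PercNearOneGluingNoHeavyLowerTailSunflowerLawPencilForms
import Literature.Probability.Percolation.FourFunctionsProdBernoulli
import Literature.Probability.Percolation.MooreShannonInfluenceBoundGeneral

/-!
# `NoHeavyLowerTail` (crux stmt-CriticalPhenomena-4575), abstract sunflower cubic at LAW level: the POLARIZED LEMMA A —
# the A-branch of the polarized (C1) dichotomy `LawPolarizedC1` HOLDS on the principal-core class, by a two-core Daykin chain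

Support file (seat `prim-ineq-gen-2` gen 29; `--supports stmt-CriticalPhenomena-4575`).  No `sorry`, no new definitions, standard axioms.
Memo: run/shared/lean/prim/prim-ineq-gen-2/SHARP-FORM-GEN29.md §3, §6.  Companion of `…SunflowerDaykinChain` (Lemma A
`μ(E₁)μ(E₂)μ(E₃) ≤ μ(A)²` on the meet–join stratum) and `…SunflowerLawPencilForms` / `…SunflowerLawPolarizedC1` (the polarized forms).

THE POLARIZED LEMMA A [this work].  For two parameter vectors `q₀, q₁` with laws `μ₀, μ₁` and a three-petal sunflower `(E₁,E₂,E₃; A)`,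
the mixed form `mixedLA` of `…LawPencilForms` is, in event probabilities (`mixedLA_cells_eq`),
`⟨m₁, ∇LA(m₀)⟩ = μ₀(A)² + 2 μ₀(A) μ₁(A) − Σ_i μ₁(E_i) μ₀(E_j) μ₀(E_k)`
(on the diagonal: `3(μ(A)² − μ(E₁)μ(E₂)μ(E₃))`, Lemma A's slack).  Along a coordinate pencil (`q₀ = p[e↦0]`, `q₁ = p[e↦1]`) one has
`μ₁(X) = μ₀(X^e)`, `X^e = {ω : ω ∪ {e} ∈ X}` (`real_update_one_eq_real_update_zero_insert`), and the TWO-CORE CHAIN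
`μ(F₁)μ(F₂)μ(F₃) ≤ μ(C₁)μ(C₂)` (`real_mul_mul_le_of_twoCores`: unions of `F₁, F₂` in `C₁`, `(S ∩ S') ∪ S''` in `C₂`; two Ahlswede–Daykin
four-events steps) bounds every mixed term: `μ₁(E_i)μ₀(E_j)μ₀(E_k) ≤ μ₀(A)μ₁(A)` and `μ₀(E_i)μ₁(E_j)μ₁(E_k) ≤ μ₁(A)²` whenever all three
meet–join conditions hold (`(S ∩ S') ∪ S'' ∈ A` for members of any two petal events and the third).  For a PRINCIPAL core `A = {g ⊆ ω}`
these hold (as in `DaykinChain.meetJoin_of_principalCore`) and moreover `μ₀(A) = 0` (if `e ∈ g`) or `μ₀(A) = μ₁(A)` (if `e ∉ g`); in the first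
case Harris (`μ₀(E_i)μ₀(E_j) ≤ μ₀(A) = 0`) kills all but one mixed term.  Hence (`mixedLA_sections_nonneg_of_principalCore`):

  for every finite three-petal sunflower of up-sets with principal core, every `p`, every `e`:
  `mixedLA m₁ m₀ ≥ 0` and `mixedLA m₀ m₁ ≥ 0` — the A-branch of `LawPolarizedC1` at both orders,

so the polarized dichotomy holds on the principal-core class for the same reason Lemma A does (and, with the proved Gladkov parts of
`…LawPencilForms`, both one-step Bernstein coefficients of `H` are `≥ 0` there: `mixedH_sections_nonneg_of_principalCore`).
-/

noncomputable section

namespace Summit.CriticalPhenomena.PercolationContinuityZ3.Theorems.SunflowerPartition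

namespace LawPencil

open MeasureTheory
open scoped SetFamily
open Literature.Probability.LatticeModels Literature.Probability.Percolation

variable {ι : Type*} [Fintype ι]

/-! ## The polarized Lemma A identity -/

/-- **`⟨m₁, ∇LA(m₀)⟩` in event probabilities**: `mixedLA (cells q₁) (cells q₀) = μ₀(A)² + 2μ₀(A)μ₁(A) − Σ_i μ₁(E_i)μ₀(E_j)μ₀(E_k)`.
[this work] -/
theorem mixedLA_cells_eq (q₁ q₀ : ι → unitInterval) {E₁ E₂ E₃ A : Set (Set ι)}
    (h12 : E₁ ∩ E₂ = A) (h13 : E₁ ∩ E₃ = A) (h23 : E₂ ∩ E₃ = A) :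
    mixedLA (cells q₁ E₁ E₂ E₃ A) (cells q₀ E₁ E₂ E₃ A) =
      (prodBernoulli q₀).real A ^ 2 + 2 * (prodBernoulli q₀).real A * (prodBernoulli q₁).real A -
        ((prodBernoulli q₁).real E₁ * (prodBernoulli q₀).real E₂ * (prodBernoulli q₀).real E₃ +
          (prodBernoulli q₁).real E₂ * (prodBernoulli q₀).real E₁ * (prodBernoulli q₀).real E₃ +
          (prodBernoulli q₁).real E₃ * (prodBernoulli q₀).real E₁ * (prodBernoulli q₀).real E₂) := by
  obtain ⟨e₁, e₂, e₃, eB⟩ := PrincipalCore.cells_eq q₀ h12 h13 h23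
  obtain ⟨f₁, f₂, f₃, fB⟩ := PrincipalCore.cells_eq q₁ h12 h13 h23
  simp only [mixedLA, cells_apply_zero, cells_apply_one, cells_apply_two, cells_apply_three, cells_apply_four]
  rw [e₁, e₂, e₃, eB, f₁, f₂, f₃, fB]
  ring

/-! ## The two-core Daykin chain and Harris, via the four-events inequality -/

/-- **Two-core chain**: if `S ∪ S' ∈ C₁` for `S ∈ F₁`, `S' ∈ F₂`, and `(S ∩ S') ∪ S'' ∈ C₂` for `S ∈ F₁`, `S' ∈ F₂`, `S'' ∈ F₃`, then
`μ(F₁)μ(F₂)μ(F₃) ≤ μ(C₁)μ(C₂)` (`μ(F₁)μ(F₂) ≤ μ(F₁ ⊼ F₂)μ(C₁)`, then `μ(F₁ ⊼ F₂)μ(F₃) ≤ μ(C₂)`). [this work] -/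
theorem real_mul_mul_le_of_twoCores (p : ι → unitInterval) {F₁ F₂ F₃ C₁ C₂ : Set (Set ι)}
    (hjoin : ∀ S ∈ F₁, ∀ S' ∈ F₂, S ∪ S' ∈ C₁)
    (hmj : ∀ S ∈ F₁, ∀ S' ∈ F₂, ∀ S'' ∈ F₃, (S ∩ S') ∪ S'' ∈ C₂) :
    (prodBernoulli p).real F₁ * (prodBernoulli p).real F₂ * (prodBernoulli p).real F₃ ≤
      (prodBernoulli p).real C₁ * (prodBernoulli p).real C₂ := by
  classical
  have step₁ := prodBernoulli_fourEvents p F₁ F₂ (F₁ ⊼ F₂) C₁ fun a ha b hb =>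
    ⟨Set.mem_infs.2 ⟨a, ha, b, hb, rfl⟩, hjoin a ha b hb⟩
  have step₂ := prodBernoulli_fourEvents p (F₁ ⊼ F₂) F₃ Set.univ C₂ fun w hw c hc => by
    obtain ⟨a, ha, b, hb, rfl⟩ := Set.mem_infs.1 hw
    exact ⟨Set.mem_univ _, hmj a ha b hb c hc⟩
  rw [probReal_univ, one_mul] at step₂
  have h₃ : 0 ≤ (prodBernoulli p).real F₃ := measureReal_nonneg
  have hC : 0 ≤ (prodBernoulli p).real C₁ := measureReal_nonneg
  calc (prodBernoulli p).real F₁ * (prodBernoulli p).real F₂ * (prodBernoulli p).real F₃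
      ≤ (prodBernoulli p).real (F₁ ⊼ F₂) * (prodBernoulli p).real C₁ * (prodBernoulli p).real F₃ :=
        mul_le_mul_of_nonneg_right step₁ h₃
    _ = (prodBernoulli p).real C₁ * ((prodBernoulli p).real (F₁ ⊼ F₂) * (prodBernoulli p).real F₃) := by ring
    _ ≤ (prodBernoulli p).real C₁ * (prodBernoulli p).real C₂ := mul_le_mul_of_nonneg_left step₂ hC

/-- **Harris through the four-events inequality**: if `S ∪ S' ∈ C` for `S ∈ F₁`, `S' ∈ F₂`, then `μ(F₁)μ(F₂) ≤ μ(C)`. [this work] -/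
theorem real_mul_le_of_joins (p : ι → unitInterval) {F₁ F₂ C : Set (Set ι)} (hjoin : ∀ S ∈ F₁, ∀ S' ∈ F₂, S ∪ S' ∈ C) :
    (prodBernoulli p).real F₁ * (prodBernoulli p).real F₂ ≤ (prodBernoulli p).real C := by
  have h := prodBernoulli_fourEvents p F₁ F₂ Set.univ C fun a ha b hb => ⟨Set.mem_univ _, hjoin a ha b hb⟩
  rwa [probReal_univ, one_mul] at h

/-! ## Sections along a coordinate pencil -/

section Pencil

variable [DecidableEq ι]

/-- **`μ_{p[e↦1]}(X) = μ_{p[e↦0]}(X^e)`**, `X^e = {ω : ω ∪ {e} ∈ X}`: the upper section law is the lower section law of the shifted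
event. [this work] -/
theorem real_update_one_eq_real_update_zero_insert (p : ι → unitInterval) (e : ι) (X : Set (Set ι)) :
    (prodBernoulli (Function.update p e 1)).real X =
      (prodBernoulli (Function.update p e 0)).real {ω : Set ι | insert e ω ∈ X} := by
  have hX : ∀ X : Set (Set ι), DeterminedBy X (↑(Finset.univ : Finset ι) : Set ι) := fun X => by
    rw [determinedBy_iff]; intro ω ω' h; simp only [Finset.coe_univ, Set.inter_univ] at h; rw [h]
  have h := prodBernoulli_real_update_one_eq (hX X) (Function.update p e 0) (Finset.mem_univ e)
  rwa [Function.update_idem] at h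

/-- The lower section law of a principal filter `{g ⊆ ω}` with `e ∈ g` vanishes. [this work] -/
theorem real_update_zero_principal_eq_zero (p : ι → unitInterval) {g : Finset ι} {e : ι} (he : e ∈ g) :
    (prodBernoulli (Function.update p e 0)).real {ω : Set ι | (g : Set ι) ⊆ ω} = 0 := by
  have hX : ∀ X : Set (Set ι), DeterminedBy X (↑(Finset.univ : Finset ι) : Set ι) := fun X => by
    rw [determinedBy_iff]; intro ω ω' h; simp only [Finset.coe_univ, Set.inter_univ] at h; rw [h]
  rw [prodBernoulli_real_update_zero_eq (hX _) p (Finset.mem_univ e)]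
  have hempty : {ω : Set ι | ω \ {e} ∈ {ω : Set ι | (g : Set ι) ⊆ ω}} = ∅ := by
    ext ω
    simp only [Set.mem_setOf_eq, Set.mem_empty_iff_false, iff_false]
    intro h
    exact (h (Finset.mem_coe.2 he)).2 (Set.mem_singleton e)
  rw [hempty, measureReal_empty]

/-- Both section laws of a principal filter `{g ⊆ ω}` with `e ∉ g` equal its law. [this work] -/
theorem real_update_principal_eq_of_not_mem (p : ι → unitInterval) {g : Finset ι} {e : ι} (he : e ∉ g) :
    (prodBernoulli (Function.update p e 0)).real {ω : Set ι | (g : Set ι) ⊆ ω} =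
        (prodBernoulli p).real {ω : Set ι | (g : Set ι) ⊆ ω} ∧
      (prodBernoulli (Function.update p e 1)).real {ω : Set ι | (g : Set ι) ⊆ ω} =
        (prodBernoulli p).real {ω : Set ι | (g : Set ι) ⊆ ω} := by
  have hX : ∀ X : Set (Set ι), DeterminedBy X (↑(Finset.univ : Finset ι) : Set ι) := fun X => by
    rw [determinedBy_iff]; intro ω ω' h; simp only [Finset.coe_univ, Set.inter_univ] at h; rw [h]
  have hne : ∀ x, x ∈ (g : Set ι) → x ≠ e := fun x hx hxe => he (by rw [← hxe]; exact Finset.mem_coe.1 hx)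
  constructor
  · rw [prodBernoulli_real_update_zero_eq (hX _) p (Finset.mem_univ e)]
    have hset : {ω : Set ι | ω \ {e} ∈ {ω : Set ι | (g : Set ι) ⊆ ω}} = {ω : Set ι | (g : Set ι) ⊆ ω} := by
      ext ω
      simp only [Set.mem_setOf_eq]
      constructor
      · exact fun h x hx => (h hx).1
      · exact fun h x hx => ⟨h hx, fun hxe => hne x hx (Set.mem_singleton_iff.1 hxe)⟩
    rw [hset]
  · rw [prodBernoulli_real_update_one_eq (hX _) p (Finset.mem_univ e)]
    have hset : {ω : Set ι | insert e ω ∈ {ω : Set ι | (g : Set ι) ⊆ ω}} = {ω : Set ι | (g : Set ι) ⊆ ω} := by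
      ext ω
      simp only [Set.mem_setOf_eq]
      constructor
      · intro h x hx
        rcases (Set.mem_insert_iff.1 (h hx)) with hxe | hxω
        · exact absurd hxe (hne x hx)
        · exact hxω
      · exact fun h x hx => Set.mem_insert_of_mem _ (h hx)
    rw [hset]

/-! ## The mixed term bounds on the meet–join stratum (all three orders) -/

/-- **First mixed bound**: `μ₁(E₃) μ₀(E₁) μ₀(E₂) ≤ μ₀(A) μ₁(A)` when `E₁ ∩ E₂ = A` (up-sets) and `(S ∩ S') ∪ S'' ∈ A` for
`S ∈ E₁`, `S' ∈ E₂`, `S'' ∈ E₃`. [this work] -/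
theorem mixed_term_le_one (p : ι → unitInterval) {E₁ E₂ E₃ A : Set (Set ι)} (h₁ : IsUpperSet E₁) (h₂ : IsUpperSet E₂)
    (h12 : E₁ ∩ E₂ = A) (hmj : ∀ S ∈ E₁, ∀ S' ∈ E₂, ∀ S'' ∈ E₃, (S ∩ S') ∪ S'' ∈ A) (e : ι) :
    (prodBernoulli (Function.update p e 1)).real E₃ * (prodBernoulli (Function.update p e 0)).real E₁ *
        (prodBernoulli (Function.update p e 0)).real E₂ ≤
      (prodBernoulli (Function.update p e 0)).real A * (prodBernoulli (Function.update p e 1)).real A := by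
  rw [real_update_one_eq_real_update_zero_insert p e E₃, real_update_one_eq_real_update_zero_insert p e A]
  have key := real_mul_mul_le_of_twoCores (Function.update p e 0) (F₁ := E₁) (F₂ := E₂)
    (F₃ := {ω : Set ι | insert e ω ∈ E₃}) (C₁ := A) (C₂ := {ω : Set ι | insert e ω ∈ A})
    (fun S hS S' hS' => h12 ▸ ⟨h₁ Set.subset_union_left hS, h₂ Set.subset_union_right hS'⟩) fun S hS S' hS' S'' hS'' => by
      rw [Set.mem_setOf_eq, ← Set.union_insert]
      exact hmj S hS S' hS' _ hS''
  calc (prodBernoulli (Function.update p e 0)).real {ω : Set ι | insert e ω ∈ E₃} *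
        (prodBernoulli (Function.update p e 0)).real E₁ * (prodBernoulli (Function.update p e 0)).real E₂
      = (prodBernoulli (Function.update p e 0)).real E₁ * (prodBernoulli (Function.update p e 0)).real E₂ *
          (prodBernoulli (Function.update p e 0)).real {ω : Set ι | insert e ω ∈ E₃} := by ring
    _ ≤ _ := key

/-- **Second mixed bound**: `μ₀(E₃) μ₁(E₁) μ₁(E₂) ≤ μ₁(A)²` under the same hypotheses. [this work] -/
theorem mixed_term_le_two (p : ι → unitInterval) {E₁ E₂ E₃ A : Set (Set ι)} (h₁ : IsUpperSet E₁) (h₂ : IsUpperSet E₂)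
    (h12 : E₁ ∩ E₂ = A) (hmj : ∀ S ∈ E₁, ∀ S' ∈ E₂, ∀ S'' ∈ E₃, (S ∩ S') ∪ S'' ∈ A) (e : ι) :
    (prodBernoulli (Function.update p e 0)).real E₃ * (prodBernoulli (Function.update p e 1)).real E₁ *
        (prodBernoulli (Function.update p e 1)).real E₂ ≤
      (prodBernoulli (Function.update p e 1)).real A ^ 2 := by
  rw [real_update_one_eq_real_update_zero_insert p e E₁, real_update_one_eq_real_update_zero_insert p e E₂,
    real_update_one_eq_real_update_zero_insert p e A]
  have key := real_mul_mul_le_of_twoCores (Function.update p e 0) (F₁ := {ω : Set ι | insert e ω ∈ E₁})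
    (F₂ := {ω : Set ι | insert e ω ∈ E₂}) (F₃ := E₃) (C₁ := {ω : Set ι | insert e ω ∈ A}) (C₂ := {ω : Set ι | insert e ω ∈ A})
    (fun S hS S' hS' => by
      rw [Set.mem_setOf_eq, ← h12]
      exact ⟨h₁ (Set.insert_subset_insert Set.subset_union_left) hS, h₂ (Set.insert_subset_insert Set.subset_union_right) hS'⟩)
    fun S hS S' hS' S'' hS'' => by
      rw [Set.mem_setOf_eq, ← Set.insert_union, Set.insert_inter_distrib]
      exact hmj _ hS _ hS' S'' hS''
  calc (prodBernoulli (Function.update p e 0)).real E₃ *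
        (prodBernoulli (Function.update p e 0)).real {ω : Set ι | insert e ω ∈ E₁} *
        (prodBernoulli (Function.update p e 0)).real {ω : Set ι | insert e ω ∈ E₂}
      = (prodBernoulli (Function.update p e 0)).real {ω : Set ι | insert e ω ∈ E₁} *
          (prodBernoulli (Function.update p e 0)).real {ω : Set ι | insert e ω ∈ E₂} *
          (prodBernoulli (Function.update p e 0)).real E₃ := by ring
    _ ≤ (prodBernoulli (Function.update p e 0)).real {ω : Set ι | insert e ω ∈ A} *
          (prodBernoulli (Function.update p e 0)).real {ω : Set ι | insert e ω ∈ A} := key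
    _ = _ := by ring

/-! ## The polarized Lemma A on the principal-core class -/

/-- **POLARIZED LEMMA A (principal cores)**: for a finite three-petal sunflower of up-sets whose core is a principal filter
`A = {g ⊆ ω}`, every `p` and every coordinate `e`, both polarized A-forms are nonnegative:
`mixedLA m₁ m₀ ≥ 0` and `mixedLA m₀ m₁ ≥ 0` (`m₀ = cells (p[e↦0])`, `m₁ = cells (p[e↦1])`) — the A-branch of `LawPolarizedC1`
at both orders. [this work] -/
theorem mixedLA_sections_nonneg_of_principalCore (p : ι → unitInterval) {E₁ E₂ E₃ A : Set (Set ι)}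
    (h₁ : IsUpperSet E₁) (h₂ : IsUpperSet E₂) (h₃ : IsUpperSet E₃)
    (h12 : E₁ ∩ E₂ = A) (h13 : E₁ ∩ E₃ = A) (h23 : E₂ ∩ E₃ = A)
    (g : Finset ι) (hA : A = {ω | (g : Set ι) ⊆ ω}) (e : ι) :
    0 ≤ mixedLA (cells (Function.update p e 1) E₁ E₂ E₃ A) (cells (Function.update p e 0) E₁ E₂ E₃ A) ∧
      0 ≤ mixedLA (cells (Function.update p e 0) E₁ E₂ E₃ A) (cells (Function.update p e 1) E₁ E₂ E₃ A) := by
  -- the meet–join condition of a principal core (cf. `DaykinChain.meetJoin_of_principalCore`): `S ∪ S'' ⊇ g` and `S' ∪ S'' ⊇ g`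
  -- force `g ∖ S'' ⊆ S ∩ S'`
  have hmj : ∀ {F₁ F₂ F₃ : Set (Set ι)}, IsUpperSet F₁ → IsUpperSet F₂ → IsUpperSet F₃ → F₁ ∩ F₃ ⊆ A → F₂ ∩ F₃ ⊆ A →
      ∀ S ∈ F₁, ∀ S' ∈ F₂, ∀ S'' ∈ F₃, (S ∩ S') ∪ S'' ∈ A := by
    intro F₁ F₂ F₃ hF₁ hF₂ hF₃ hF13 hF23 S hS S' hS' S'' hS''
    have hg1 : (g : Set ι) ⊆ S ∪ S'' := by
      have : S ∪ S'' ∈ A := hF13 ⟨hF₁ Set.subset_union_left hS, hF₃ Set.subset_union_right hS''⟩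
      rw [hA] at this; exact this
    have hg2 : (g : Set ι) ⊆ S' ∪ S'' := by
      have : S' ∪ S'' ∈ A := hF23 ⟨hF₂ Set.subset_union_left hS', hF₃ Set.subset_union_right hS''⟩
      rw [hA] at this; exact this
    rw [hA]
    intro x hx
    rcases hg1 hx with hxS | hxS''
    · rcases hg2 hx with hxS' | hxS''
      · exact Or.inl ⟨hxS, hxS'⟩
      · exact Or.inr hxS''
    · exact Or.inr hxS''
  -- the three instances (third event `E₃`, `E₂`, `E₁` respectively)
  have hmj₃ := hmj h₁ h₂ h₃ h13.le h23.le
  have hmj₂ := hmj h₁ h₃ h₂ h12.le (by rw [Set.inter_comm]; exact h23.le)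
  have hmj₁ := hmj h₂ h₃ h₁ (by rw [Set.inter_comm]; exact h12.le) (by rw [Set.inter_comm]; exact h13.le)
  -- notation
  set μ₀ := prodBernoulli (Function.update p e 0) with hμ₀
  set μ₁ := prodBernoulli (Function.update p e 1) with hμ₁
  -- mixed term bounds
  have t₃ : μ₁.real E₃ * μ₀.real E₁ * μ₀.real E₂ ≤ μ₀.real A * μ₁.real A := mixed_term_le_one p h₁ h₂ h12 hmj₃ e
  have t₂ : μ₁.real E₂ * μ₀.real E₁ * μ₀.real E₃ ≤ μ₀.real A * μ₁.real A := mixed_term_le_one p h₁ h₃ h13 hmj₂ e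
  have t₁ : μ₁.real E₁ * μ₀.real E₂ * μ₀.real E₃ ≤ μ₀.real A * μ₁.real A := mixed_term_le_one p h₂ h₃ h23 hmj₁ e
  have u₃ : μ₀.real E₃ * μ₁.real E₁ * μ₁.real E₂ ≤ μ₁.real A ^ 2 := mixed_term_le_two p h₁ h₂ h12 hmj₃ e
  have u₂ : μ₀.real E₂ * μ₁.real E₁ * μ₁.real E₃ ≤ μ₁.real A ^ 2 := mixed_term_le_two p h₁ h₃ h13 hmj₂ e
  have u₁ : μ₀.real E₁ * μ₁.real E₂ * μ₁.real E₃ ≤ μ₁.real A ^ 2 := mixed_term_le_two p h₂ h₃ h23 hmj₁ e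
  -- Harris under `μ₀`
  have k12 : μ₀.real E₁ * μ₀.real E₂ ≤ μ₀.real A :=
    real_mul_le_of_joins _ fun S hS S' hS' => h12 ▸ ⟨h₁ Set.subset_union_left hS, h₂ Set.subset_union_right hS'⟩
  have k13 : μ₀.real E₁ * μ₀.real E₃ ≤ μ₀.real A :=
    real_mul_le_of_joins _ fun S hS S' hS' => h13 ▸ ⟨h₁ Set.subset_union_left hS, h₃ Set.subset_union_right hS'⟩
  have k23 : μ₀.real E₂ * μ₀.real E₃ ≤ μ₀.real A :=
    real_mul_le_of_joins _ fun S hS S' hS' => h23 ▸ ⟨h₂ Set.subset_union_left hS, h₃ Set.subset_union_right hS'⟩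
  -- nonnegativity
  have n₁ : 0 ≤ μ₀.real E₁ := measureReal_nonneg
  have n₂ : 0 ≤ μ₀.real E₂ := measureReal_nonneg
  have n₃ : 0 ≤ μ₀.real E₃ := measureReal_nonneg
  have m₁ : 0 ≤ μ₁.real E₁ := measureReal_nonneg
  have m₂ : 0 ≤ μ₁.real E₂ := measureReal_nonneg
  have m₃ : 0 ≤ μ₁.real E₃ := measureReal_nonneg
  have ha₁ : 0 ≤ μ₁.real A := measureReal_nonneg
  rw [mixedLA_cells_eq _ _ h12 h13 h23, mixedLA_cells_eq _ _ h12 h13 h23]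
  -- the core dichotomy `μ₀(A) = 0 ∨ μ₀(A) = μ₁(A)`
  by_cases he : e ∈ g
  · have ha0 : μ₀.real A = 0 := by rw [hμ₀, hA]; exact real_update_zero_principal_eq_zero p he
    rw [ha0] at t₁ t₂ t₃ k12 k13 k23
    rw [ha0]
    have z12 : μ₀.real E₁ * μ₀.real E₂ = 0 := le_antisymm k12 (mul_nonneg n₁ n₂)
    have z13 : μ₀.real E₁ * μ₀.real E₃ = 0 := le_antisymm k13 (mul_nonneg n₁ n₃)
    have z23 : μ₀.real E₂ * μ₀.real E₃ = 0 := le_antisymm k23 (mul_nonneg n₂ n₃)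
    refine ⟨by nlinarith [mul_nonneg (mul_nonneg m₁ n₂) n₃, mul_nonneg (mul_nonneg m₂ n₁) n₃,
      mul_nonneg (mul_nonneg m₃ n₁) n₂], ?_⟩
    rcases mul_eq_zero.1 z12 with hz | hz
    · rcases mul_eq_zero.1 z23 with hz' | hz'
      · rw [hz, hz']; nlinarith [u₃]
      · rw [hz, hz']; nlinarith [u₂]
    · rcases mul_eq_zero.1 z13 with hz' | hz'
      · rw [hz, hz']; nlinarith [u₃]
      · rw [hz, hz']; nlinarith [u₁]
  · have hsec := real_update_principal_eq_of_not_mem p he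
    have ha01 : μ₀.real A = μ₁.real A := by rw [hμ₀, hμ₁, hA, hsec.1, hsec.2]
    rw [ha01] at t₁ t₂ t₃
    rw [ha01]
    constructor
    · nlinarith [t₁, t₂, t₃]
    · nlinarith [u₁, u₂, u₃]

/-- **Both one-step Bernstein coefficients of `H` are nonnegative on the principal-core class** (polarized Lemma A + the proved
Gladkov parts): `mixedH m₁ m₀ ≥ 0` and `mixedH m₀ m₁ ≥ 0`. [this work] -/
theorem mixedH_sections_nonneg_of_principalCore (p : ι → unitInterval) {E₁ E₂ E₃ A : Set (Set ι)}
    (h₁ : IsUpperSet E₁) (h₂ : IsUpperSet E₂) (h₃ : IsUpperSet E₃)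
    (h12 : E₁ ∩ E₂ = A) (h13 : E₁ ∩ E₃ = A) (h23 : E₂ ∩ E₃ = A)
    (g : Finset ι) (hA : A = {ω | (g : Set ι) ⊆ ω}) (e : ι) :
    0 ≤ mixedH (cells (Function.update p e 1) E₁ E₂ E₃ A) (cells (Function.update p e 0) E₁ E₂ E₃ A) ∧
      0 ≤ mixedH (cells (Function.update p e 0) E₁ E₂ E₃ A) (cells (Function.update p e 1) E₁ E₂ E₃ A) := by
  obtain ⟨hk1, hk2⟩ := mixedLA_sections_nonneg_of_principalCore p h₁ h₂ h₃ h12 h13 h23 g hA e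
  have hA' := mixedH_cells_nonneg_of_mixedLA_nonneg (Function.update p e 1) (Function.update p e 0)
    (update_zero_le_update_one p e) h₁ h₂ h₃ h12 h13 h23
  exact ⟨hA'.1 hk1, hA'.2 hk2⟩

end Pencil

end LawPencil

end Summit.CriticalPhenomena.PercolationContinuityZ3.Theorems.SunflowerPartition

end
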